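/-
Copyright (c) 2026 the pub-hodgecm-mathlib formalisation cell (harness21).  Prover seat hodgecm-mathlib-K2E1-p15 (g4), Track B ∕ K2-LIT, h413 = `stmt-HodgeConjecture-24833`, route `HCCMUnconditional`,
R90-TF section S8 «ContSpec-n½», ESTATE T (ruling J-S8-T2) PORTS, FIRST PAIR (S8 dealer R90-CS-plan (g3), S8-R211 (1) 2026-09-05T01:45:30Z): the `τ`-twins of ★ 12d-I
`K2E1EquivariantSectionLine` ∕ ★ 12d-C `K2E1ChiHeckeArchScalarU2`, HYPOTHESIS-FIRST on the slice line; census `R90/S8/CENSUS-HeckeArchScalarTau.K2E1-p15-g4.md` cc09141d518ac805.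
-/
import Summits.HodgeConjecture.HodgeConjecture.Theorems.K2E1ChiHeckeArchScalarU2        -- ★ 12d-C (K2-defs1, p859887): §0 `exists_mem_comap_borel_mul_mem_comap_K_arch`; brings ★ 12d-I, ★ `exists_integral_eq_smul_integral_adelicProdEquiv`,
                                                                                        --   ★ `flatSectionU`∕`continuous_flatSectionU`, ★ `borelHeight_mul_of_mem_comap_standardMaximalCompactGL`, ★ `archPart`∕`finPart`
import HarnessLib

/-!
# ESTATE T, FIRST PAIR — `K2E1ChiHeckeArchScalarTauU2`: THE `τ`-TWINS OF ★ 12d-I ∕ ★ 12d-C — A `K`-CENTRAL KERNEL ACTS BY ONE SCALAR ON EVERY `K`-EQUIVARIANT COPY OF A `K`-TYPE `W`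
# INSIDE THE `(B, c_B)`-SECTIONS AS SOON AS THOSE COPIES FORM A LINE (`Hom_K(W, I(c_B))` of dimension `≤ 1`); hence an archimedean-only `K_∞`-central test function `h = h_∞ ⊗ 𝟙_U`
# acts on a `W`-ISOTYPIC space `V` of sections on `G(𝔸)` by ONE scalar `s(z)` on `V ⊗ H^z` — the letter `h12dCτ` of the second pair (`K2E1ChiGaugeSymbolTauCMThree`, K2E2-p12)

Cell `pub/hodgecm-mathlib`, crux H413 = `stmt-HodgeConjecture-24833`.  THEOREMS ONLY (no `def`, no `instance`, no notation, no named-fact hypothesis, no `sorry`; default heartbeats); lane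
`--supports stmt-HodgeConjecture-24833 --as helper` (count-neutral).  CLOSES NO SOCKET.  §1 is group-generic (any group `G`, subgroups `B`, `K`, function `c_B`, any `ℂ`-module `W` with a bare
action map `τ : G → End W` read on `K` only); §2–§3 are generic in the quadratic datum `(F, E, c)` and the rank `N` (the «U2» in the name marks the twin of the ★ U2-named generic file), over a
BARE `V : Submodule ℂ (G(𝔸) → ℂ)` (the engine's currency, ★ `exists_chi_convData_cm_three`): no `K′ ∕ ω ∕ hKinf`, no τ-defs import.

THE MATHEMATICS ([Knapp1986, VII §1–§2]; [BernsteinLapid2019, §4 Claim 1]; [MoeglinWaldspurger1995, I.2.17]; [BorelJacquet1979, §4.1]).  `I(c_B)` = the `(B, c_B)`-sections `A(b g) = c_B(b)A(g)` on `G`,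
with `K` acting by right translation `r(k)`.  For a `K`-type `(W, τ)` a **τ-EMBEDDING** is a linear `j : W → I(c_B)` with `r(k) ∘ j = j ∘ τ(k)` (`k ∈ K`): an element of `Hom_K(W, I(c_B))`.  (§1a) If
`G = B·K`, `j` is determined by its CO-WEIGHT FUNCTIONAL `λ_j(w) := (j w)(1)`, and `λ_j(τ(m)w) = c_B(m)λ_j(w)` on `M := B ∩ K` (FROBENIUS `Hom_K(W, Ind_M^K c_B) ↪ Hom_M(W, c_B)`); so if the
`(M, c_B)`-co-weight functionals form a line, the τ-embeddings form a LINE `{c • j₀}` — the hypothesis `hline` (for `U(2,1)`: every character of `M_v` has multiplicity `≤ 1` in every irreducible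
`K_v`-type, ★ `R90S8KTypeSliceLineU3.exists_forall_homSpace_torus_eq_smul_of_transpose_realisation`, K2E1-p14).  (§1b) Right convolution `R_h A(g) = ∫ h(y)A(g y)dμ(y)` by a `K`-CENTRAL kernel
against a two-sided invariant measure preserves `I(c_B)` and commutes with `r(k)` (substitution `y ↦ k⁻¹yk`, integrability-free); on an INTEGRABLE τ-embedding it is linear, so `R_h ∘ j` is again a
τ-embedding, hence `R_h ∘ j = ĉ • j` with ONE `ĉ` for all integrable `j` (HEAD of §1; at `dim W = 1` this is ★ 12d-I, where homogeneity replaced integrability).  (§2) On `G(𝔸) = G_∞·G_f` with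
`ι = archToAdelic`, `ι_f = finAdelicToAdelic`, `B_∞ := ι⁻¹B(𝔸)`, `K_∞ := ι⁻¹K` (★ 12d-C §0 spelling): for a space `V` of continuous functions, right-invariant under `ι_f(U)` (`U ⊆ K`), whose flat
sections obey an archimedean left law `f_z^φ(ι(b a)x_f) = c_z(b)f_z^φ(ι(a)x_f)` (`b ∈ B_∞`) and which is `W`-ISOTYPIC — spanned by the images of its `K_∞`-equivariant maps `J : W → V` — every SLICE
MAP `σ_{x_f,z} : v ↦ (a ↦ f_z^{Jv}(ι(a)·ι_f x_f))` is a τ-embedding into `I_∞(c_z)` (`ι(k)` commutes with `ι_f(x_f)`, `H` is right-`K`-invariant), so a `K_∞`-central `h_∞` acts on all slices by ONE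
`ĉ(z)` (§1 + `Submodule.iSup_induction`), and ★ 12d-C's Fubini computation (`κ`, `integral_prod_mul`, right-`U`-invariance) gives `∫_G (h_∞ ⊗ 𝟙_U)(y)f_z^φ(xy)dy = s·f_z^φ(x)`,
`s := κ·μ_f(U)·ĉ(z)`, for ALL `φ ∈ V` and `x` — the body of K2E2-p12 (g10)'s letter `h12dCτ` byte for byte.  (§3) The same with `hline` replaced by the `z`-FREE co-weight line on `M_∞ = B_∞ ∩ K_∞`
(`c_z|_{M_∞}` is `z`-free: the modulus is trivial on the compact `M_∞`), via §1a and ★ arch Iwasawa `G_∞ = B_∞K_∞`.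
* §1a `emb_apply_mul`, `coweight_of_emb`, `emb_eq_smul_of_apply_one`, **`exists_line_of_coweightLine`** (Frobenius: co-weight line ⇒ embedding line); §1b `integral_mul_apply_conj_eq`
  (`∫ h(y)A(g k y) = ∫ h(y)A(g y k)`), **`exists_rightConv_emb_eq_smul_of_central`** (HEAD 12d-I_τ); §2 `flatSectionU_archToAdelic_mul_of_equivariant`, **`exists_integral_pureTensor_mul_flatSectionU_eq_tau`**
  (HEAD 12d-C_τ = `h12dCτ`); §3 **`exists_integral_pureTensor_mul_flatSectionU_eq_tau_of_coweightLine`** (`c ≠ 1` fixing the infinite places; the co-weight line in place of `hline`).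
HONEST LABEL: HC_CM is proved only modulo the 7 printed citations (2 remaining named inputs: hLiu418 = `stmt-HodgeConjecture-24832`, h413 = `stmt-HodgeConjecture-24833`) until rung 0
closes; hypothesis-first port — `hline` ∕ the co-weight line and the `W`-isotypy `hVτ` stay letters of the assembler; asserts no named fact, closes no socket; count-neutral.

## References
* [Knapp1986] A. W. Knapp, *Representation Theory of Semisimple Groups* (1986), VII §1–§2 (induced representations, `K`-types of the principal series, Frobenius reciprocity).
* [BernsteinLapid2019] J. Bernstein, E. Lapid, *On the meromorphic continuation of Eisenstein series*, J. Amer. Math. Soc. 37 (2024) (arXiv:1911.02342), §4 Claim 1.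
* [MoeglinWaldspurger1995] C. Mœglin, J.-L. Waldspurger, *Spectral Decomposition and Eisenstein Series* (1995), I.2.17.
* [BorelJacquet1979] A. Borel, H. Jacquet, *Automorphic forms and automorphic representations*, Proc. Symp. Pure Math. 33.1 (1979), §4.1.
-/

set_option autoImplicit false
-- the mandated namespace repeats the single-problem summit's segment (`HodgeConjecture.HodgeConjecture`)
set_option linter.dupNamespace false

noncomputable section

open MeasureTheory Measure NumberField IsDedekindDomain NumberField.InfinitePlace NumberField.mixedEmbedding
open scoped NNReal MatrixGroups Classical
open Literature.NumberTheory.Automorphic Literature.NumberTheory.Automorphic.UnitaryGroup AdelicGroupData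
open Summit.HodgeConjecture.HodgeConjecture.Cruxes.H413.K2E1BorelEisensteinU

namespace Summit.HodgeConjecture.HodgeConjecture.Cruxes.H413.K2E1ChiHeckeArchScalarTauU2

/-! ## §1 The `τ`-twin of ★ 12d-I (group-generic): `K`-equivariant copies of a `K`-type inside the `(B, c_B)`-sections, and the one-scalar action of a `K`-central kernel on their line -/

section Generic

variable {G : Type*} [Group G] (B K : Subgroup G) (cB : G → ℂ) {W : Type*} [AddCommGroup W] [Module ℂ W] (τ : G → W →ₗ[ℂ] W)

/-! ### §1a Frobenius: a τ-embedding is determined by its co-weight functional `w ↦ (j w)(1)` -/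

/-- **Evaluation of a τ-embedding on `B·K`**: `(j w)(b k) = c_B(b)·(j (τ k w))(1)`. [cite: Knapp1986, VII §1] -/
theorem emb_apply_mul {j : W →ₗ[ℂ] (G → ℂ)} (hjB : ∀ w, ∀ b ∈ B, ∀ g, j w (b * g) = cB b * j w g)
    (hjK : ∀ k ∈ K, ∀ (w : W) (g : G), j w (g * k) = j (τ k w) g) {b k : G} (hb : b ∈ B) (hk : k ∈ K) (w : W) :
    j w (b * k) = cB b * j (τ k w) 1 := by
  have h1 : j w k = j (τ k w) 1 := by simpa only [one_mul] using hjK k hk w 1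
  rw [hjB w b hb, h1]

/-- **The co-weight law of the value-at-one functional**: for a τ-embedding `j` and `m ∈ B ∩ K`, `(j (τ m w))(1) = c_B(m)·(j w)(1)` — `λ_j := (w ↦ (j w)(1)) ∈ Hom_M(W, c_B)`, the Frobenius image
of `j ∈ Hom_K(W, I(c_B))`. [cite: Knapp1986, VII §2] -/
theorem coweight_of_emb {j : W →ₗ[ℂ] (G → ℂ)} (hjB : ∀ w, ∀ b ∈ B, ∀ g, j w (b * g) = cB b * j w g)
    (hjK : ∀ k ∈ K, ∀ (w : W) (g : G), j w (g * k) = j (τ k w) g) {m : G} (hmB : m ∈ B) (hmK : m ∈ K) (w : W) :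
    j (τ m w) 1 = cB m * j w 1 := by
  have h1 : j w m = j (τ m w) 1 := by simpa only [one_mul] using hjK m hmK w 1
  have h2 : j w m = cB m * j w 1 := by simpa only [mul_one] using hjB w m hmB 1
  rw [← h1, h2]

/-- **A τ-embedding is determined by its co-weight functional** (`G = B·K`): if `(j w)(1) = c·(j′ w)(1)` for all `w`, then `j = c • j′`. [cite: Knapp1986, VII §1–§2] -/
theorem emb_eq_smul_of_apply_one (hBK : ∀ g : G, ∃ b ∈ B, ∃ k ∈ K, g = b * k)
    {j j' : W →ₗ[ℂ] (G → ℂ)} (hjB : ∀ w, ∀ b ∈ B, ∀ g, j w (b * g) = cB b * j w g) (hjK : ∀ k ∈ K, ∀ (w : W) (g : G), j w (g * k) = j (τ k w) g)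
    (hj'B : ∀ w, ∀ b ∈ B, ∀ g, j' w (b * g) = cB b * j' w g) (hj'K : ∀ k ∈ K, ∀ (w : W) (g : G), j' w (g * k) = j' (τ k w) g)
    {a : ℂ} (h1 : ∀ w, j w 1 = a * j' w 1) : j = a • j' := by
  ext w g
  obtain ⟨b, hb, k, hk, rfl⟩ := hBK g
  rw [LinearMap.smul_apply, Pi.smul_apply, smul_eq_mul, emb_apply_mul B K cB τ hjB hjK hb hk, emb_apply_mul B K cB τ hj'B hj'K hb hk, h1]
  ring

/-- **FROBENIUS — THE CO-WEIGHT LINE GIVES THE EMBEDDING LINE** (`G = B·K`): if the `(M, c_B)`-co-weight functionals of `(W, τ)` (`M = B ∩ K`: the linear `λ : W → ℂ` with `λ(τ(m)w) = c_B(m)λ(w)`)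
form a line `{c • λ₀}`, then so do the τ-embeddings: `∃ j₀, ∀` τ-embedding `j`, `∃ c, j = c • j₀` — the hypothesis `hline` of the heads below, in the shape of ★
`exists_forall_homSpace_eq_smul_of_commute_orbitalOp`.  (The archimedean multiplicity one «`dim Hom_{K_∞}(τ, I(χ_∞, z)) ≤ 1`» from «`τ|_{M_∞}` is multiplicity-free».)
[cite: Knapp1986, VII §2] [cite: MoeglinWaldspurger1995, I.2.17] -/
theorem exists_line_of_coweightLine (hBK : ∀ g : G, ∃ b ∈ B, ∃ k ∈ K, g = b * k)
    (hco : ∃ l₀ : W →ₗ[ℂ] ℂ, ∀ l : W →ₗ[ℂ] ℂ, (∀ m ∈ B, m ∈ K → ∀ w, l (τ m w) = cB m * l w) → ∃ c : ℂ, l = c • l₀) :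
    ∃ j₀ : W →ₗ[ℂ] (G → ℂ), ∀ j : W →ₗ[ℂ] (G → ℂ), (∀ w, ∀ b ∈ B, ∀ g, j w (b * g) = cB b * j w g) →
      (∀ k ∈ K, ∀ (w : W) (g : G), j w (g * k) = j (τ k w) g) → ∃ c : ℂ, j = c • j₀ := by
  obtain ⟨l₀, hl₀⟩ := hco
  by_cases hex : ∃ j₁ : W →ₗ[ℂ] (G → ℂ), (∀ w, ∀ b ∈ B, ∀ g, j₁ w (b * g) = cB b * j₁ w g) ∧
      (∀ k ∈ K, ∀ (w : W) (g : G), j₁ w (g * k) = j₁ (τ k w) g) ∧ ∃ w, j₁ w 1 ≠ 0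
  · obtain ⟨j₁, h₁B, h₁K, w₁, hw₁⟩ := hex
    refine ⟨j₁, fun j hjB hjK => ?_⟩
    -- the two co-weight functionals `λ_j`, `λ_{j₁}` are multiples of `l₀`, and `λ_{j₁} ≠ 0`
    obtain ⟨a, ha⟩ := hl₀ ((LinearMap.proj (1 : G) : (G → ℂ) →ₗ[ℂ] ℂ) ∘ₗ j) fun m hmB hmK w => by
      simpa only [LinearMap.comp_apply, LinearMap.proj_apply] using coweight_of_emb B K cB τ hjB hjK hmB hmK w
    obtain ⟨a₁, ha₁⟩ := hl₀ ((LinearMap.proj (1 : G) : (G → ℂ) →ₗ[ℂ] ℂ) ∘ₗ j₁) fun m hmB hmK w => by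
      simpa only [LinearMap.comp_apply, LinearMap.proj_apply] using coweight_of_emb B K cB τ h₁B h₁K hmB hmK w
    have e1 : ∀ w, j w 1 = a * l₀ w := fun w => by
      simpa only [LinearMap.comp_apply, LinearMap.proj_apply, LinearMap.smul_apply, smul_eq_mul] using LinearMap.congr_fun ha w
    have e2 : ∀ w, j₁ w 1 = a₁ * l₀ w := fun w => by
      simpa only [LinearMap.comp_apply, LinearMap.proj_apply, LinearMap.smul_apply, smul_eq_mul] using LinearMap.congr_fun ha₁ w
    have ha₁0 : a₁ ≠ 0 := fun h0 => hw₁ (by rw [e2, h0, zero_mul])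
    refine ⟨a / a₁, emb_eq_smul_of_apply_one B K cB τ hBK hjB hjK h₁B h₁K fun w => ?_⟩
    rw [e1, e2, ← mul_assoc, div_mul_cancel₀ a ha₁0]
  · -- every τ-embedding has vanishing co-weight functional, hence vanishes
    push Not at hex
    refine ⟨0, fun j hjB hjK => ⟨0, ?_⟩⟩
    rw [smul_zero]
    ext w g
    obtain ⟨b, hb, k, hk, rfl⟩ := hBK g
    rw [emb_apply_mul B K cB τ hjB hjK hb hk, hex j hjB hjK (τ k w), mul_zero, LinearMap.zero_apply, Pi.zero_apply]

/-! ### §1b A `K`-central right convolution acts on the line of τ-embeddings by one scalar -/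

section Conv

variable [MeasurableSpace G] (μ : Measure G)

/-- **The substitution `y ↦ k⁻¹ y k`**: for a `K`-central kernel `h` (`h(k⁻¹yk) = h(y)`) and a measure invariant under left AND right translations, `∫ h(y)·A(g k y) dμ = ∫ h(y)·A(g y k) dμ` for every
function `A` (no integrability needed) — `R_h` commutes with the right translation `r(k)`. [cite: BernsteinLapid2019, §4 Claim 1] [cite: Knapp1986, VII §1] -/
theorem integral_mul_apply_conj_eq [MeasurableMul G] [μ.IsMulLeftInvariant] [μ.IsMulRightInvariant] {h : G → ℂ}
    (hcent : ∀ k ∈ K, ∀ y, h (k⁻¹ * y * k) = h y) (A : G → ℂ) {k : G} (hk : k ∈ K) (g : G) :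
    ∫ y, h y * A (g * k * y) ∂μ = ∫ y, h y * A (g * y * k) ∂μ := by
  set e : G ≃ᵐ G := (MeasurableEquiv.mulLeft k⁻¹).trans (MeasurableEquiv.mulRight k) with he
  have hecoe : ∀ y, e y = k⁻¹ * y * k := fun _ => rfl
  have hmap : μ.map e = μ := by
    rw [show (⇑e) = (fun y : G => y * k) ∘ (fun y : G => k⁻¹ * y) from funext fun y => rfl,
      ← Measure.map_map (measurable_mul_const k) (measurable_const_mul k⁻¹), map_mul_left_eq_self, map_mul_right_eq_self]
  calc ∫ y, h y * A (g * k * y) ∂μ = ∫ y, h y * A (g * k * y) ∂(μ.map e) := by rw [hmap]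
    _ = ∫ y, h (e y) * A (g * k * e y) ∂μ := integral_map_equiv e _
    _ = ∫ y, h y * A (g * y * k) ∂μ := by
        refine integral_congr_ae (Filter.Eventually.of_forall fun y => ?_)
        dsimp only
        rw [hecoe, hcent k hk y, show g * k * (k⁻¹ * y * k) = g * y * k by group]

/-- **HEAD OF §1 (the `τ`-twin of ★ 12d-I `exists_rightConv_eq_smul_of_central`) — ONE SCALAR `ĉ` ON THE LINE OF τ-EMBEDDINGS**: if the τ-embeddings `W → I(c_B)` form a line (`hline`), then right
convolution by a `K`-central kernel `h` against a two-sided invariant measure acts on every INTEGRABLE τ-embedding `j` (all `y ↦ h(y)·(j w)(g y)` integrable) by one and the same scalar: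
`∫ h(y)·(j w)(g y) dμ = ĉ·(j w)(g)` for all `w`, `g`.  (`R_h ∘ j` is linear by integrability, lands in `I(c_B)`, and is `K`-equivariant by `integral_mul_apply_conj_eq`, so it lies on the line; `ĉ` is
pinned by any non-zero integrable τ-embedding, and `ĉ := 0` if there is none.) [cite: BernsteinLapid2019, §4 Claim 1] [cite: Knapp1986, VII §1–§2] [cite: MoeglinWaldspurger1995, I.2.17] -/
theorem exists_rightConv_emb_eq_smul_of_central [MeasurableMul G] [μ.IsMulLeftInvariant] [μ.IsMulRightInvariant]
    (hline : ∃ j₀ : W →ₗ[ℂ] (G → ℂ), ∀ j : W →ₗ[ℂ] (G → ℂ), (∀ w, ∀ b ∈ B, ∀ g, j w (b * g) = cB b * j w g) →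
      (∀ k ∈ K, ∀ (w : W) (g : G), j w (g * k) = j (τ k w) g) → ∃ c : ℂ, j = c • j₀)
    {h : G → ℂ} (hcent : ∀ k ∈ K, ∀ y, h (k⁻¹ * y * k) = h y) :
    ∃ ĉ : ℂ, ∀ j : W →ₗ[ℂ] (G → ℂ), (∀ w, ∀ b ∈ B, ∀ g, j w (b * g) = cB b * j w g) →
      (∀ k ∈ K, ∀ (w : W) (g : G), j w (g * k) = j (τ k w) g) → (∀ (w : W) (g : G), Integrable (fun y => h y * j w (g * y)) μ) →
      ∀ (w : W) (g : G), ∫ y, h y * j w (g * y) ∂μ = ĉ * j w g := by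
  obtain ⟨j₀, hj₀⟩ := hline
  by_cases hex : ∃ j₁ : W →ₗ[ℂ] (G → ℂ), (∀ w, ∀ b ∈ B, ∀ g, j₁ w (b * g) = cB b * j₁ w g) ∧
      (∀ k ∈ K, ∀ (w : W) (g : G), j₁ w (g * k) = j₁ (τ k w) g) ∧ (∀ (w : W) (g : G), Integrable (fun y => h y * j₁ w (g * y)) μ) ∧ j₁ ≠ 0
  · obtain ⟨j₁, h₁B, h₁K, h₁i, h₁0⟩ := hex
    -- `R_h ∘ j₁` is a τ-embedding (linear by integrability)
    let R : W →ₗ[ℂ] (G → ℂ) :=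
      { toFun := fun w g => ∫ y, h y * j₁ w (g * y) ∂μ
        map_add' := fun w w' => by
          funext g
          simp only [map_add, Pi.add_apply, mul_add]
          exact integral_add (h₁i w g) (h₁i w' g)
        map_smul' := fun a w => by
          funext g
          simp only [map_smul, Pi.smul_apply, smul_eq_mul, RingHom.id_apply, ← integral_const_mul]
          exact integral_congr_ae (Filter.Eventually.of_forall fun y => by ring) }
    have hRapp : ∀ (w : W) (g : G), R w g = ∫ y, h y * j₁ w (g * y) ∂μ := fun _ _ => rfl
    have hRB : ∀ w, ∀ b ∈ B, ∀ g, R w (b * g) = cB b * R w g := fun w b hb g => by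
      rw [hRapp, hRapp, ← integral_const_mul]
      exact integral_congr_ae (Filter.Eventually.of_forall fun y => by dsimp only; rw [mul_assoc b g y, h₁B w b hb, mul_left_comm])
    have hRK : ∀ k ∈ K, ∀ (w : W) (g : G), R w (g * k) = R (τ k w) g := fun k hk w g => by
      rw [hRapp, hRapp, integral_mul_apply_conj_eq K μ hcent (j₁ w) hk g]
      exact integral_congr_ae (Filter.Eventually.of_forall fun y => by dsimp only; rw [h₁K k hk w (g * y)])
    obtain ⟨a, ha⟩ := hj₀ R hRB hRK
    obtain ⟨a₁, ha₁⟩ := hj₀ j₁ h₁B h₁K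
    have ha₁0 : a₁ ≠ 0 := fun h0 => h₁0 (by rw [ha₁, h0, zero_smul])
    -- on `j₁`: `R_h ∘ j₁ = (a / a₁) • j₁`
    have hR : ∀ (w : W) (g : G), ∫ y, h y * j₁ w (g * y) ∂μ = a / a₁ * j₁ w g := fun w g => by
      have hw := congrFun (LinearMap.congr_fun ha w) g
      rw [hRapp, LinearMap.smul_apply, Pi.smul_apply, smul_eq_mul] at hw
      rw [hw, ha₁, LinearMap.smul_apply, Pi.smul_apply, smul_eq_mul, ← mul_assoc, div_mul_cancel₀ a ha₁0]
    refine ⟨a / a₁, fun j hjB hjK _ w g => ?_⟩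
    obtain ⟨a', ha'⟩ := hj₀ j hjB hjK
    have hj : j = (a' / a₁) • j₁ := by rw [ha', ha₁, smul_smul, div_mul_cancel₀ a' ha₁0]
    rw [hj]
    simp only [LinearMap.smul_apply, Pi.smul_apply, smul_eq_mul]
    have hlin : ∫ y, h y * (a' / a₁ * j₁ w (g * y)) ∂μ = a' / a₁ * ∫ y, h y * j₁ w (g * y) ∂μ := by
      rw [← integral_const_mul]
      exact integral_congr_ae (Filter.Eventually.of_forall fun y => by ring)
    rw [hlin, hR w g]
    ring
  · -- no non-zero integrable τ-embedding: `ĉ := 0`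
    push Not at hex
    refine ⟨0, fun j hjB hjK hji w g => ?_⟩
    rw [hex j hjB hjK hji]
    simp

end Conv

end Generic

/-! ## §2 The `τ`-twin of ★ 12d-C: an archimedean-only `K_∞`-central pure tensor acts on a `W`-isotypic space of sections on `G(𝔸)` by ONE scalar on `V ⊗ H^z` -/

section Adelic

variable {F E : Type} [Field F] [NumberField F] [Field E] [NumberField E] [Algebra F E] {c : E ≃ₐ[F] E} {N : ℕ} [NeZero N]

/-- **SLICES OF `K_∞`-EQUIVARIANT COPIES ARE `K_∞`-EQUIVARIANT**: for a linear `J : W → (G(𝔸) → ℂ)` with `J v (x·ι k) = J (τ k v) x` (`k ∈ K_∞ = ι⁻¹K`), every `z` and finite-adelic `x_f`,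
`f_z^{Jv}(ι(a k)·ι_f x_f) = f_z^{J(τ k v)}(ι(a)·ι_f x_f)` — `ι(k)` commutes with `ι_f(x_f)` (★ `commute_archToAdelic_finAdelicToAdelic`) and `H` is right-`K`-invariant
(★ `borelHeight_mul_of_mem_comap_standardMaximalCompactGL`). [cite: BorelJacquet1979, §4.1] [cite: MoeglinWaldspurger1995, I.2.17] -/
theorem flatSectionU_archToAdelic_mul_of_equivariant {W : Type*} [AddCommGroup W] [Module ℂ W]
    (τ : arch F E c N ((StdForm.antidiagonal N).over E) → W →ₗ[ℂ] W) {J : W →ₗ[ℂ] ((quasiSplit F E c N).Adelic → ℂ)}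
    (hJK : ∀ k ∈ (((standardMaximalCompactGL N E).comap (adelicVal F E c N ((StdForm.antidiagonal N).over E))).comap (archToAdelic F E c N ((StdForm.antidiagonal N).over E))),
      ∀ (v : W) (x : (quasiSplit F E c N).Adelic), J v (x * archToAdelic F E c N _ k) = J (τ k v) x)
    (z : ℂ) (xf : finAdelic F E c N ((StdForm.antidiagonal N).over E))
    {k : arch F E c N ((StdForm.antidiagonal N).over E)}
    (hk : k ∈ (((standardMaximalCompactGL N E).comap (adelicVal F E c N ((StdForm.antidiagonal N).over E))).comap (archToAdelic F E c N ((StdForm.antidiagonal N).over E))))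
    (v : W) (a : arch F E c N ((StdForm.antidiagonal N).over E)) :
    flatSectionU (J v) z (archToAdelic F E c N _ (a * k) * finAdelicToAdelic F E c N _ xf) =
      flatSectionU (J (τ k v)) z (archToAdelic F E c N _ a * finAdelicToAdelic F E c N _ xf) := by
  have hkK : adelicVal F E c N ((StdForm.antidiagonal N).over E) (archToAdelic F E c N _ k) ∈ standardMaximalCompactGL N E :=
    Subgroup.mem_comap.1 (Subgroup.mem_comap.1 hk)
  rw [flatSectionU_apply, flatSectionU_apply, map_mul, mul_assoc, (commute_archToAdelic_finAdelicToAdelic F E c N _ k xf).eq, ← mul_assoc,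
    hJK k hk v, borelHeight_mul_of_mem_comap_standardMaximalCompactGL (Subgroup.mem_comap.2 hkK)]

variable [MeasurableSpace (quasiSplit F E c N).Adelic] [BorelSpace (quasiSplit F E c N).Adelic]
variable [MeasurableSpace (arch F E c N ((StdForm.antidiagonal N).over E))] [BorelSpace (arch F E c N ((StdForm.antidiagonal N).over E))]
variable [MeasurableSpace (finAdelic F E c N ((StdForm.antidiagonal N).over E))] [BorelSpace (finAdelic F E c N ((StdForm.antidiagonal N).over E))]
variable (νG : Measure (quasiSplit F E c N).Adelic) [νG.IsHaarMeasure]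
variable (μa : Measure (arch F E c N ((StdForm.antidiagonal N).over E))) [μa.IsHaarMeasure] [μa.IsMulRightInvariant]
variable (μf : Measure (finAdelic F E c N ((StdForm.antidiagonal N).over E))) [μf.IsHaarMeasure]
-- THE V-SIDE BINDERS shared by the heads of §2 and §3 (see the docstring of `exists_integral_pureTensor_mul_flatSectionU_eq_tau`)
variable (V : Submodule ℂ ((quasiSplit F E c N).Adelic → ℂ)) (hVc : ∀ φ ∈ V, Continuous φ)
  {U : Set (finAdelic F E c N ((StdForm.antidiagonal N).over E))}
  (hUK : ∀ b ∈ U, adelicVal F E c N ((StdForm.antidiagonal N).over E) (finAdelicToAdelic F E c N _ b) ∈ standardMaximalCompactGL N E)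
  (hVU : ∀ φ ∈ V, ∀ b ∈ U, ∀ x : (quasiSplit F E c N).Adelic, φ (x * finAdelicToAdelic F E c N _ b) = φ x)
  {W : Type*} [AddCommGroup W] [Module ℂ W] (τ : arch F E c N ((StdForm.antidiagonal N).over E) → W →ₗ[ℂ] W)
  (cB : ℂ → arch F E c N ((StdForm.antidiagonal N).over E) → ℂ)
  (hVB : ∀ (z : ℂ), ∀ φ ∈ V, ∀ b ∈ (borelAdelic F E c N).comap (archToAdelic F E c N ((StdForm.antidiagonal N).over E)),
    ∀ (a : arch F E c N ((StdForm.antidiagonal N).over E)) (xf : finAdelic F E c N ((StdForm.antidiagonal N).over E)),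
      flatSectionU φ z (archToAdelic F E c N _ (b * a) * finAdelicToAdelic F E c N _ xf) = cB z b * flatSectionU φ z (archToAdelic F E c N _ a * finAdelicToAdelic F E c N _ xf))
  (hVτ : V ≤ ⨆ (J : W →ₗ[ℂ] ((quasiSplit F E c N).Adelic → ℂ)) (_ : LinearMap.range J ≤ V ∧
    ∀ k ∈ (((standardMaximalCompactGL N E).comap (adelicVal F E c N ((StdForm.antidiagonal N).over E))).comap (archToAdelic F E c N ((StdForm.antidiagonal N).over E))),
      ∀ (v : W) (x : (quasiSplit F E c N).Adelic), J v (x * archToAdelic F E c N _ k) = J (τ k v) x), LinearMap.range J)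

include μa μf hVc hUK hVU hVB hVτ in
/-- **HEAD OF §2 (the `τ`-twin of ★ 12d-C `exists_integral_pureTensor_mul_flatSectionU_eq`; the letter `h12dCτ` of `K2E1ChiGaugeSymbolTauCMThree`) — `∫_G (h_∞ ⊗ 𝟙_U)(y)·f_z^φ(x y) dν_G = s·f_z^φ(x)`
WITH ONE `s` FOR ALL `φ ∈ V` AND ALL `x`**.  Binders: the BARE space `V` of CONTINUOUS functions on `G(𝔸)` (`hVc`); a FREE set `U ⊆ G(𝔸_f)` inside `K` (`hUK`, so `H(x·ι_f b) = H(x)`) under which `V` is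
right-invariant (`hVU`); a `K_∞`-type `(W, τ)` (`τ` a bare map, read on `K_∞ = ι⁻¹K` only); the archimedean LEFT LAW of the flat sections of `V` along `B_∞ = ι⁻¹B(𝔸)` with factor `cB z`
(`hVB`; single- or pair-character currency alike); the `W`-ISOTYPY of `V` (`hVτ`: `V` is spanned by the images of its `K_∞`-equivariant linear maps `J : W → V`); THE LINE `hline z` of the
τ-embeddings `W → I_∞(cB z)` (§1; from the co-weight line by `exists_line_of_coweightLine`, §3); then ★ 12d-C's bytes: `h` continuous of compact support, `h = h_∞ ⊗ 𝟙_U` (`hten`), `h_∞`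
`K_∞`-central (`hcent`), `z`.  Proof: ★ 12d-C's Fubini computation with ★ 12d-I replaced by §1's head on the slice embeddings `σ_{x_f,z} ∘ J` (integrable: `h_∞ = h(ι(·)·ι_f b₀)` for any `b₀ ∈ U`
is `C_c`, the slices are continuous) and `Submodule.iSup_induction` along `hVτ`; `U = ∅` gives `h = 0`, `s := 0`; else `s := κ·(∫_{G_f}𝟙_U dμ_f)·ĉ(z)`.
[cite: BernsteinLapid2019, §4 Claim 1] [cite: Knapp1986, VII §1–§2] [cite: BorelJacquet1979, §4.1] [cite: MoeglinWaldspurger1995, I.2.17] -/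
theorem exists_integral_pureTensor_mul_flatSectionU_eq_tau
    (hline : ∀ z : ℂ, ∃ j₀ : W →ₗ[ℂ] (arch F E c N ((StdForm.antidiagonal N).over E) → ℂ), ∀ j : W →ₗ[ℂ] (arch F E c N ((StdForm.antidiagonal N).over E) → ℂ),
      (∀ w, ∀ b ∈ (borelAdelic F E c N).comap (archToAdelic F E c N ((StdForm.antidiagonal N).over E)), ∀ g, j w (b * g) = cB z b * j w g) →
      (∀ k ∈ (((standardMaximalCompactGL N E).comap (adelicVal F E c N ((StdForm.antidiagonal N).over E))).comap (archToAdelic F E c N ((StdForm.antidiagonal N).over E))),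
        ∀ (w : W) (g : arch F E c N ((StdForm.antidiagonal N).over E)), j w (g * k) = j (τ k w) g) → ∃ a : ℂ, j = a • j₀)
    {h : (quasiSplit F E c N).Adelic → ℂ} {hinf : arch F E c N ((StdForm.antidiagonal N).over E) → ℂ}
    (hh : Continuous h) (hhs : HasCompactSupport h)
    (hten : ∀ y, h y = hinf (archPart F E c N _ y) * U.indicator (fun _ => (1 : ℂ)) (finPart F E c N _ y))
    (hcent : ∀ k ∈ (((standardMaximalCompactGL N E).comap (adelicVal F E c N ((StdForm.antidiagonal N).over E))).comap (archToAdelic F E c N ((StdForm.antidiagonal N).over E))),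
      ∀ y, hinf (k⁻¹ * y * k) = hinf y) (z : ℂ) :
    ∃ s : ℂ, ∀ φ ∈ V, ∀ x : (quasiSplit F E c N).Adelic,
      ∫ y, h y * flatSectionU φ z (x * y) ∂νG = s * flatSectionU φ z x := by
  letI : MeasurableSpace (adelic F E c N ((StdForm.antidiagonal N).over E)) := ‹MeasurableSpace (quasiSplit F E c N).Adelic›
  haveI : BorelSpace (adelic F E c N ((StdForm.antidiagonal N).over E)) := ⟨‹BorelSpace (quasiSplit F E c N).Adelic›.measurable_eq⟩
  haveI : @Measure.IsHaarMeasure (↥(adelic F E c N ((StdForm.antidiagonal N).over E))) _ _ _ νG :=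
    { lt_top_of_isCompact := fun K hK => IsFiniteMeasureOnCompacts.lt_top_of_isCompact (μ := νG) hK
      map_mul_left_eq_self := fun g => map_mul_left_eq_self νG g
      open_pos := fun U hU hne => IsOpenPosMeasure.open_pos (μ := νG) U hU hne }
  rcases U.eq_empty_or_nonempty with hU0 | ⟨b₀, hb₀⟩
  · refine ⟨0, fun φ _ x => ?_⟩
    have h0 : ∀ y, h y = 0 := fun y => by rw [hten, hU0, Set.indicator_empty, mul_zero]
    simp only [h0, zero_mul, integral_zero]
  -- `h_∞ = h(ι(·)·ι_f b₀)` is continuous of compact support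
  have hhinf_eq : ∀ a, hinf a = h (archToAdelic F E c N _ a * finAdelicToAdelic F E c N _ b₀) := fun a => by
    rw [hten, map_mul, map_mul, archPart_archToAdelic, archPart_finAdelicToAdelic, finPart_archToAdelic, finPart_finAdelicToAdelic, mul_one, one_mul,
      Set.indicator_of_mem hb₀, mul_one]
  have hhinf : Continuous hinf := by
    rw [show hinf = _ from funext hhinf_eq]; exact hh.comp ((continuous_archToAdelic F E c N _).mul continuous_const)
  have hhinfs : HasCompactSupport hinf := by
    refine HasCompactSupport.of_support_subset_isCompact (hhs.image (continuous_archPart F E c N ((StdForm.antidiagonal N).over E))) fun a ha => ?_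
    rw [Function.mem_support, hhinf_eq] at ha
    refine ⟨_, subset_tsupport _ (Function.mem_support.2 ha), ?_⟩
    rw [map_mul, archPart_archToAdelic, archPart_finAdelicToAdelic, mul_one]
  obtain ⟨ĉ, hĉ⟩ := exists_rightConv_emb_eq_smul_of_central
    ((borelAdelic F E c N).comap (archToAdelic F E c N ((StdForm.antidiagonal N).over E)))
    (((standardMaximalCompactGL N E).comap (adelicVal F E c N ((StdForm.antidiagonal N).over E))).comap (archToAdelic F E c N ((StdForm.antidiagonal N).over E)))
    (cB z) τ μa (hline z) hcent
  have hint : ∀ ψ ∈ V, ∀ (a₀ : arch F E c N ((StdForm.antidiagonal N).over E)) (xf : finAdelic F E c N ((StdForm.antidiagonal N).over E)),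
      Integrable (fun y => hinf y * flatSectionU ψ z (archToAdelic F E c N _ (a₀ * y) * finAdelicToAdelic F E c N _ xf)) μa := fun ψ hψ a₀ xf =>
    (hhinf.mul ((continuous_flatSectionU (hVc ψ hψ) z).comp
      (((continuous_archToAdelic F E c N _).comp (continuous_const.mul continuous_id)).mul continuous_const))).integrable_of_hasCompactSupport hhinfs.mul_right
  -- ONE scalar on all slices of all `φ ∈ V`: the property `P` below holds on every equivariant copy `J(W)` (§1 on the slice embedding `σ_{x_f,z} ∘ J`) and is additive, so `hVτ` spreads it over `V`
  let P : ((quasiSplit F E c N).Adelic → ℂ) → Prop := fun ψ => ψ ∈ V ∧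
    ∀ (a₀ : arch F E c N ((StdForm.antidiagonal N).over E)) (xf : finAdelic F E c N ((StdForm.antidiagonal N).over E)),
      ∫ y, hinf y * flatSectionU ψ z (archToAdelic F E c N _ (a₀ * y) * finAdelicToAdelic F E c N _ xf) ∂μa = ĉ * flatSectionU ψ z (archToAdelic F E c N _ a₀ * finAdelicToAdelic F E c N _ xf)
  have hP0 : P 0 := ⟨V.zero_mem, fun a₀ xf => by simp only [flatSectionU_apply, Pi.zero_apply, zero_mul, mul_zero, integral_zero]⟩
  have hPadd : ∀ ψ₁ ψ₂, P ψ₁ → P ψ₂ → P (ψ₁ + ψ₂) := by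
    rintro ψ₁ ψ₂ ⟨h₁V, h₁⟩ ⟨h₂V, h₂⟩
    refine ⟨V.add_mem h₁V h₂V, fun a₀ xf => ?_⟩
    have hadd : ∀ y : (quasiSplit F E c N).Adelic, flatSectionU (ψ₁ + ψ₂) z y = flatSectionU ψ₁ z y + flatSectionU ψ₂ z y := fun y => by
      simp only [flatSectionU_apply, Pi.add_apply, add_mul]
    simp only [hadd, mul_add]
    rw [integral_add (hint ψ₁ h₁V a₀ xf) (hint ψ₂ h₂V a₀ xf), h₁ a₀ xf, h₂ a₀ xf]
  have hPJ : ∀ J : W →ₗ[ℂ] ((quasiSplit F E c N).Adelic → ℂ), (LinearMap.range J ≤ V ∧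
      ∀ k ∈ (((standardMaximalCompactGL N E).comap (adelicVal F E c N ((StdForm.antidiagonal N).over E))).comap (archToAdelic F E c N ((StdForm.antidiagonal N).over E))),
        ∀ (v : W) (x : (quasiSplit F E c N).Adelic), J v (x * archToAdelic F E c N _ k) = J (τ k v) x) → ∀ ψ ∈ LinearMap.range J, P ψ := by
    rintro J ⟨hJV, hJK⟩ ψ hψ
    obtain ⟨v, rfl⟩ := LinearMap.mem_range.1 hψ
    refine ⟨hJV (LinearMap.mem_range_self J v), fun a₀ xf => ?_⟩
    let σ : W →ₗ[ℂ] (arch F E c N ((StdForm.antidiagonal N).over E) → ℂ) :=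
      { toFun := fun w a => flatSectionU (J w) z (archToAdelic F E c N _ a * finAdelicToAdelic F E c N _ xf)
        map_add' := fun w w' => by
          funext a
          simp only [map_add, flatSectionU_apply, Pi.add_apply, add_mul]
        map_smul' := fun r w => by
          funext a
          simp only [map_smul, flatSectionU_apply, Pi.smul_apply, smul_eq_mul, RingHom.id_apply, mul_assoc] }
    have hσ : ∀ (w : W) (a : arch F E c N ((StdForm.antidiagonal N).over E)), σ w a = flatSectionU (J w) z (archToAdelic F E c N _ a * finAdelicToAdelic F E c N _ xf) := fun _ _ => rfl
    have hσB : ∀ w, ∀ b ∈ (borelAdelic F E c N).comap (archToAdelic F E c N ((StdForm.antidiagonal N).over E)), ∀ g, σ w (b * g) = cB z b * σ w g :=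
      fun w b hb g => by rw [hσ, hσ, hVB z (J w) (hJV (LinearMap.mem_range_self J w)) b hb g xf]
    have hσK : ∀ k ∈ (((standardMaximalCompactGL N E).comap (adelicVal F E c N ((StdForm.antidiagonal N).over E))).comap (archToAdelic F E c N ((StdForm.antidiagonal N).over E))),
        ∀ (w : W) (g : arch F E c N ((StdForm.antidiagonal N).over E)), σ w (g * k) = σ (τ k w) g :=
      fun k hk w g => by rw [hσ, hσ, flatSectionU_archToAdelic_mul_of_equivariant τ hJK z xf hk w g]
    exact hĉ σ hσB hσK (fun w g => hint (J w) (hJV (LinearMap.mem_range_self J w)) g xf) v a₀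
  have hslice : ∀ φ ∈ V, P φ := fun φ hφ =>
    Submodule.iSup_induction _ (motive := P) (hVτ hφ) (fun J ψ hψ => Submodule.iSup_induction _ (motive := P) hψ (hPJ J) hP0 hPadd) hP0 hPadd
  obtain ⟨κ, -, hκ⟩ := exists_integral_eq_smul_integral_adelicProdEquiv F E c N ((StdForm.antidiagonal N).over E) νG μa μf
  refine ⟨(κ : ℂ) * ((∫ b, U.indicator (fun _ => (1 : ℂ)) b ∂μf) * ĉ), fun φ hφ x => ?_⟩
  set a₀ := archPart F E c N ((StdForm.antidiagonal N).over E) x with ha₀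
  set xf := finPart F E c N ((StdForm.antidiagonal N).over E) x with hxf
  have hx : x = archToAdelic F E c N _ a₀ * finAdelicToAdelic F E c N _ xf := (archToAdelic_mul_finAdelicToAdelic F E c N _ x).symm
  have hintg : ∀ p : arch F E c N ((StdForm.antidiagonal N).over E) × finAdelic F E c N ((StdForm.antidiagonal N).over E),
      h (archToAdelic F E c N _ p.1 * finAdelicToAdelic F E c N _ p.2) * flatSectionU φ z (x * (archToAdelic F E c N _ p.1 * finAdelicToAdelic F E c N _ p.2)) =
        (hinf p.1 * flatSectionU φ z (archToAdelic F E c N _ (a₀ * p.1) * finAdelicToAdelic F E c N _ xf)) * U.indicator (fun _ => (1 : ℂ)) p.2 := by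
    rintro ⟨a, b⟩
    dsimp only
    rw [hten, map_mul, map_mul, archPart_archToAdelic, archPart_finAdelicToAdelic, finPart_archToAdelic, finPart_finAdelicToAdelic, mul_one, one_mul]
    by_cases hb : b ∈ U
    · rw [Set.indicator_of_mem hb, hx, mul_one, mul_one,
        show archToAdelic F E c N _ a₀ * finAdelicToAdelic F E c N _ xf * (archToAdelic F E c N _ a * finAdelicToAdelic F E c N _ b) =
          archToAdelic F E c N _ (a₀ * a) * finAdelicToAdelic F E c N _ xf * finAdelicToAdelic F E c N _ b by
            rw [map_mul, mul_assoc, ← mul_assoc (finAdelicToAdelic F E c N _ xf), ← (commute_archToAdelic_finAdelicToAdelic F E c N _ a xf).eq]; simp only [mul_assoc],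
        flatSectionU_apply, flatSectionU_apply, hVU φ hφ b hb, borelHeight_mul_of_mem_comap_standardMaximalCompactGL (Subgroup.mem_comap.2 (hUK b hb))]
    · rw [Set.indicator_of_notMem hb, mul_zero, zero_mul, mul_zero]
  have step1 : ∫ y, h y * flatSectionU φ z (x * y) ∂νG =
      (κ : ℝ) • ∫ p : arch F E c N ((StdForm.antidiagonal N).over E) × finAdelic F E c N ((StdForm.antidiagonal N).over E),
        h (archToAdelic F E c N _ p.1 * finAdelicToAdelic F E c N _ p.2) * flatSectionU φ z (x * (archToAdelic F E c N _ p.1 * finAdelicToAdelic F E c N _ p.2)) ∂(μa.prod μf) :=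
    hκ (fun y : (quasiSplit F E c N).Adelic => h y * flatSectionU φ z (x * y))
  haveI := sFinite_haar_finAdelic F E c N ((StdForm.antidiagonal N).over E) μf
  have step2 : ∫ p : arch F E c N ((StdForm.antidiagonal N).over E) × finAdelic F E c N ((StdForm.antidiagonal N).over E),
      hinf p.1 * flatSectionU φ z (archToAdelic F E c N _ (a₀ * p.1) * finAdelicToAdelic F E c N _ xf) * U.indicator (fun _ => (1 : ℂ)) p.2 ∂(μa.prod μf) =
        (∫ a, hinf a * flatSectionU φ z (archToAdelic F E c N _ (a₀ * a) * finAdelicToAdelic F E c N _ xf) ∂μa) * ∫ b, U.indicator (fun _ => (1 : ℂ)) b ∂μf :=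
    integral_prod_mul (fun a => hinf a * flatSectionU φ z (archToAdelic F E c N _ (a₀ * a) * finAdelicToAdelic F E c N _ xf)) (U.indicator fun _ => (1 : ℂ))
  rw [step1, integral_congr_ae (Filter.Eventually.of_forall hintg), step2, (hslice φ hφ).2 a₀ xf, ← hx, Complex.real_smul]
  ring

/-! ## §3 The head with the `z`-free co-weight line in place of `hline` (Frobenius §1a + ★ arch Iwasawa `G_∞ = B_∞·K_∞`) -/

include μa μf hVc hUK hVU hVB hVτ in
/-- **HEAD OF §3 — THE SAME SCALAR ACTION FROM THE CO-WEIGHT LINE**: as `exists_integral_pureTensor_mul_flatSectionU_eq_tau` (same V-side binders), with `hline` replaced by (i) a `z`-FREE function `χM`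
on `G_∞` agreeing with every `cB z` on `M_∞ = B_∞ ∩ K_∞` (`hcBM`; the modulus `‖·‖^z` is trivial on the compact `M_∞`) and (ii) the CO-WEIGHT LINE «the linear `λ : W → ℂ` with `λ(τ(m)w) = χM(m)λ(w)`
(`m ∈ M_∞`) form a line `{c • λ₀}`» — the Frobenius image of the multiplicity-one line of ★ `R90S8KTypeSliceLineU3` (weight vectors ↔ co-weight functionals by unitarity, assembler's glue) —
and `c ≠ 1` fixing every infinite place (★ 12d-C §0 arch Iwasawa `exists_mem_comap_borel_mul_mem_comap_K_arch`, the `G = B·K` of §1a).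
[cite: Knapp1986, VII §1–§2] [cite: BernsteinLapid2019, §4 Claim 1] [cite: BorelJacquet1979, §4.1] [cite: MoeglinWaldspurger1995, I.2.17] -/
theorem exists_integral_pureTensor_mul_flatSectionU_eq_tau_of_coweightLine (hc : c ≠ 1) (hfix : ∀ w : InfinitePlace E, c • w = w)
    (χM : arch F E c N ((StdForm.antidiagonal N).over E) → ℂ)
    (hcBM : ∀ (z : ℂ), ∀ m ∈ (borelAdelic F E c N).comap (archToAdelic F E c N ((StdForm.antidiagonal N).over E)),
      m ∈ (((standardMaximalCompactGL N E).comap (adelicVal F E c N ((StdForm.antidiagonal N).over E))).comap (archToAdelic F E c N ((StdForm.antidiagonal N).over E))) → cB z m = χM m)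
    (hco : ∃ l₀ : W →ₗ[ℂ] ℂ, ∀ l : W →ₗ[ℂ] ℂ, (∀ m ∈ (borelAdelic F E c N).comap (archToAdelic F E c N ((StdForm.antidiagonal N).over E)),
      m ∈ (((standardMaximalCompactGL N E).comap (adelicVal F E c N ((StdForm.antidiagonal N).over E))).comap (archToAdelic F E c N ((StdForm.antidiagonal N).over E))) →
        ∀ w, l (τ m w) = χM m * l w) → ∃ a : ℂ, l = a • l₀)
    {h : (quasiSplit F E c N).Adelic → ℂ} {hinf : arch F E c N ((StdForm.antidiagonal N).over E) → ℂ}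
    (hh : Continuous h) (hhs : HasCompactSupport h)
    (hten : ∀ y, h y = hinf (archPart F E c N _ y) * U.indicator (fun _ => (1 : ℂ)) (finPart F E c N _ y))
    (hcent : ∀ k ∈ (((standardMaximalCompactGL N E).comap (adelicVal F E c N ((StdForm.antidiagonal N).over E))).comap (archToAdelic F E c N ((StdForm.antidiagonal N).over E))),
      ∀ y, hinf (k⁻¹ * y * k) = hinf y) (z : ℂ) :
    ∃ s : ℂ, ∀ φ ∈ V, ∀ x : (quasiSplit F E c N).Adelic,
      ∫ y, h y * flatSectionU φ z (x * y) ∂νG = s * flatSectionU φ z x := by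
  refine exists_integral_pureTensor_mul_flatSectionU_eq_tau νG μa μf V hVc hUK hVU τ cB hVB hVτ (fun z' => ?_) hh hhs hten hcent z
  obtain ⟨l₀, hl₀⟩ := hco
  exact exists_line_of_coweightLine _ _ (cB z') τ (K2E1ChiHeckeArchScalarU2.exists_mem_comap_borel_mul_mem_comap_K_arch hc hfix) ⟨l₀, fun l hl => hl₀ l fun m hmB hmK w => by
    rw [← hcBM z' m hmB hmK]; exact hl m hmB hmK w⟩

end Adelic

end Summit.HodgeConjecture.HodgeConjecture.Cruxes.H413.K2E1ChiHeckeArchScalarTauU2
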